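import Summits.ResolutionOfSingularities.ResolutionOfSingularities.Theorems.LossIsFatal
import Summits.ResolutionOfSingularities.ResolutionOfSingularities.Theorems.WallCutBottom
import HarnessLib

/-!
# LossIsFatalLedger — the q-UNIFORM LEDGER SKELETON of `LossIsFatal`: consecutive losses telescope, the surviving loss is
followed by a PROXIMITY REPEAT, and the defective branch is confined to the wide cells (kernel, hypothesis-free,
port-free; all `p`, `e`, `K`)

decomp-res-lens-3, gen 27 (row 214 window, line (α): «(R′) OUTRIGHT by branch type»; this file is the branch-free part
T6 of the NODE-g26 §8 table, typed for every `q = pᵉ` at once).  Everything here is PURE LEDGER (`BoundaryLedger.r_succ_eq`,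
`kept_apply`, `order_eq_shade_add_degree`, `walk_nat`) — no polynomial enters.

* `loss_data` — a total loss at a plateau stage `t` (`ordZero F_t = q + m ≠ q`): `ordZero F_{t+1} = s + m`, `m ≥ 1`,
  `kept_t = 0`, `r_{t+1} = m·e_j` (any defect; `WallCutBottom.bottom_loss_data` is the case `s + m = q + 1`).
* `loss_consecutive` — if the move after a total loss is NOT a proximity repeat (`¬ StaysOnNewest W t`: same chart again, or
  the new wall translated away) then stage `t+1` is AGAIN a total loss, with the smaller parameter `m' = s + m − q < m`.
* `LossIsFatalStaysDeep` + `lossIsFatalDeep_of_stays` — hence (strong induction on `m`) `LossIsFatalDeep` REDUCES to total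
  losses followed by a proximity repeat: chart switch `i ≠ j` with the centre ON the new wall (`b_{t+1}(j) = 0`).
* `loss_stays_shape` — after such a loss: `kept_{t+1} = m·e_j`, `r_{t+2} = m·e_j + (δ+1)·e_i`, `ordZero F_{t+2} = q + 2δ + 2`
  (`δ = ordZero F_{t+1} − q − 1` the loss defect).
* `LossIsFatalBottomStaysDeep` (`δ = 0`) / `LossIsFatalDefectStaysDeep` (`δ ≥ 1`, with the FREE extra binder `pᵉ + 3 ≤ 2s`:
  `defect_loss_wide`) and the assemblies `lossIsFatalStaysDeep_of_branches`,
`noLossyStrictTailsDeep_of_stays_branches` (PROVED):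
  the located residual `WallCut.NoLossyStrictTailsDeep` follows from the two STAYS branches.
-/

open MvPolynomial Finset
open Literature.AlgebraicGeometry.Resolution
open Literature.AlgebraicGeometry.Resolution.Hauser2010
open Literature.AlgebraicGeometry.Resolution.PointBlowup
open Summit.ResolutionOfSingularities.ResolutionOfSingularities.Theorems.TightDefectClasses
open Summit.ResolutionOfSingularities.ResolutionOfSingularities.Theorems.TightDefectStrongWalks
open Summit.ResolutionOfSingularities.ResolutionOfSingularities.Theorems.ItineraryCutClasses
open Summit.ResolutionOfSingularities.ResolutionOfSingularities.Theorems.BoundaryLedger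
open Summit.ResolutionOfSingularities.ResolutionOfSingularities.Theorems.ProximityCut
open Summit.ResolutionOfSingularities.ResolutionOfSingularities.Theorems.WallCutRun
open Summit.ResolutionOfSingularities.ResolutionOfSingularities.Theorems.WallCut
open Summit.ResolutionOfSingularities.ResolutionOfSingularities.Theorems.WallCutCritical
open Summit.ResolutionOfSingularities.ResolutionOfSingularities.Theorems.LossIsFatal

namespace Summit.ResolutionOfSingularities.ResolutionOfSingularities.Theorems.LossIsFatalLedger

/-! ## §1 Pure-ledger data of a total loss -/

section Ledger

variable {K : Type} [Field K] [DecidableEq K] {q : ℕ} {s₀ : State (Fin 3) K}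

/-- **DATA OF A TOTAL LOSS (PROVED, any defect).**  On a plateau of shade `s`, a total loss at `t` (`r_{t+1}` vanishes off
the chart `j = j_t`) from `ordZero F_t = q + m ≠ q` has `ordZero F_{t+1} = s + m`, `m ≥ 1`, `q + m = s + |r_t|`, `kept_t = 0`,
`r_{t+1} = m·e_j`. [new] [folklore] -/
theorem loss_data (hroot : IsRoot q s₀) (W : ForcedWalk q s₀) (t : ℕ) {s : ℕ}
    (hsh0 : (W.st t).shade = (s : ℕ∞)) (hsh1 : (W.st (t + 1)).shade = (s : ℕ∞))
    (hloss : ∀ y, y ≠ W.j t → (W.st (t + 1)).r y = 0) (hne : ordZero (W.st t).F ≠ ((q : ℕ) : ℕ∞)) :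
    ∃ m : ℕ, ordZero (W.st t).F = ((q + m : ℕ) : ℕ∞) ∧ ordZero (W.st (t + 1)).F = ((s + m : ℕ) : ℕ∞) ∧ 1 ≤ m ∧
      q + m = s + (W.st t).r.degree ∧ kept W t = 0 ∧ (W.st (t + 1)).r = Finsupp.single (W.j t) m := by
  classical
  obtain ⟨o, ho, hqo⟩ := walk_nat hroot W t
  obtain ⟨s', hs', hos'⟩ := order_eq_shade_add_degree hroot W t ho
  have hss' : s' = s := by have h := hs'.symm.trans hsh0; exact_mod_cast h
  have hkept : kept W t = 0 := by
    ext y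
    by_cases hy : y = W.j t
    · rw [kept_apply, if_neg (fun h => h.1 hy)]; rfl
    · have h1 := hloss y hy
      rw [r_succ_eq W t ho, Finsupp.add_apply, Finsupp.single_apply, if_neg (fun h => hy h.symm), add_zero] at h1
      rw [h1]; rfl
  have hdeg := degree_r_succ W t ho
  rw [hkept, map_zero, zero_add] at hdeg
  obtain ⟨o1, ho1, -⟩ := walk_nat hroot W (t + 1)
  obtain ⟨s'', hs'', hos''⟩ := order_eq_shade_add_degree hroot W (t + 1) ho1
  have hss'' : s'' = s := by have h := hs''.symm.trans hsh1; exact_mod_cast h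
  have hoq : o ≠ q := by
    intro h; rw [h] at ho; exact hne ho
  refine ⟨o - q, ?_, ?_, by omega, by omega, hkept, ?_⟩
  · rw [ho]; congr 1; omega
  · rw [ho1]; congr 1; omega
  · rw [r_succ_eq W t ho, hkept, zero_add]

/-- **CONSECUTIVE LOSSES (PROVED).**  If the move after a total loss at `t` is NOT a proximity repeat — the same chart again,
or a chart switch whose centre leaves the new wall `E_j` (`b_{t+1}(j) ≠ 0`) — then stage `t+1` is again a total loss.
[new] [folklore] -/
theorem loss_consecutive (hroot : IsRoot q s₀) (W : ForcedWalk q s₀) (t : ℕ) {s : ℕ}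
    (hsh0 : (W.st t).shade = (s : ℕ∞)) (hsh1 : (W.st (t + 1)).shade = (s : ℕ∞))
    (hloss : ∀ y, y ≠ W.j t → (W.st (t + 1)).r y = 0) (hne : ordZero (W.st t).F ≠ ((q : ℕ) : ℕ∞))
    (hnst : ¬ StaysOnNewest W t) : ∀ y, y ≠ W.j (t + 1) → (W.st (t + 2)).r y = 0 := by
  classical
  obtain ⟨m, -, -, -, -, -, hr1⟩ := loss_data hroot W t hsh0 hsh1 hloss hne
  obtain ⟨o1, ho1, -⟩ := walk_nat hroot W (t + 1)
  intro y hy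
  show (W.st (t + 1 + 1)).r y = 0
  rw [r_succ_eq W (t + 1) ho1, Finsupp.add_apply, Finsupp.single_apply, if_neg (fun h => hy h.symm), add_zero,
    kept_apply, hr1, Finsupp.single_apply]
  by_cases hyj : W.j t = y
  · rw [if_pos hyj]
    have hb : W.b (t + 1) y ≠ 0 := by
      intro hb
      exact hnst ⟨fun h => hy (h ▸ hyj).symm, hyj ▸ hb⟩
    rw [if_neg (fun h => hb h.2)]
  · rw [if_neg hyj]
    split_ifs <;> rfl

/-- **SHAPE AFTER A LOSS FOLLOWED BY A PROXIMITY REPEAT (PROVED).**  Total loss at `t` (`ordZero F_t = q + m ≠ q`), the next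
move a proximity repeat into chart `i = j_{t+1} ≠ j` (`b_{t+1}(j) = 0`), plateau through `t+2`, `ordZero F_{t+1} ≠ q`: with
the loss defect `δ` (`ordZero F_{t+1} = q + 1 + δ = s + m`) one has `kept_{t+1} = m·e_j`, `r_{t+2} = m·e_j + (δ+1)·e_i`,
`ordZero F_{t+2} = q + 2δ + 2`. [new] [folklore] -/
theorem loss_stays_shape (hroot : IsRoot q s₀) (W : ForcedWalk q s₀) (t : ℕ) {s : ℕ}
    (hsh0 : (W.st t).shade = (s : ℕ∞)) (hsh1 : (W.st (t + 1)).shade = (s : ℕ∞)) (hsh2 : (W.st (t + 2)).shade = (s : ℕ∞))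
    (hloss : ∀ y, y ≠ W.j t → (W.st (t + 1)).r y = 0) (hne : ordZero (W.st t).F ≠ ((q : ℕ) : ℕ∞))
    (hne1 : ordZero (W.st (t + 1)).F ≠ ((q : ℕ) : ℕ∞)) (hst : StaysOnNewest W t) :
    ∃ m δ : ℕ, ordZero (W.st t).F = ((q + m : ℕ) : ℕ∞) ∧ ordZero (W.st (t + 1)).F = ((q + 1 + δ : ℕ) : ℕ∞) ∧
      s + m = q + 1 + δ ∧ 1 ≤ m ∧ (W.st (t + 1)).r = Finsupp.single (W.j t) m ∧
      kept W (t + 1) = Finsupp.single (W.j t) m ∧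
      (W.st (t + 2)).r = Finsupp.single (W.j t) m + Finsupp.single (W.j (t + 1)) (δ + 1) ∧
      ordZero (W.st (t + 2)).F = ((q + 2 * δ + 2 : ℕ) : ℕ∞) := by
  classical
  obtain ⟨m, hot, hot1, h1m, -, -, hr1⟩ := loss_data hroot W t hsh0 hsh1 hloss hne
  obtain ⟨o1, ho1, hqo1⟩ := walk_nat hroot W (t + 1)
  have ho1' : o1 = s + m := by have h := ho1.symm.trans hot1; exact_mod_cast h
  have ho1q : o1 ≠ q := by intro h; rw [h] at ho1; exact hne1 ho1
  have hkept : kept W (t + 1) = Finsupp.single (W.j t) m := by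
    ext y
    rw [kept_apply, hr1, Finsupp.single_apply]
    by_cases hyj : W.j t = y
    · rw [if_pos hyj, if_pos ⟨fun h => hst.1 (h ▸ hyj).symm, hyj ▸ hst.2⟩]
    · rw [if_neg hyj]
      split_ifs <;> rfl
  have hr2 : (W.st (t + 2)).r = Finsupp.single (W.j t) m + Finsupp.single (W.j (t + 1)) (o1 - q) := by
    show (W.st (t + 1 + 1)).r = _
    rw [r_succ_eq W (t + 1) ho1, hkept]
  obtain ⟨o2, ho2, -⟩ := walk_nat hroot W (t + 2)
  obtain ⟨s2, hs2, hos2⟩ := order_eq_shade_add_degree hroot W (t + 2) ho2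
  have hss2 : s2 = s := by have h := hs2.symm.trans hsh2; exact_mod_cast h
  have hdeg2 : (W.st (t + 2)).r.degree = m + (o1 - q) := by
    rw [hr2, map_add, Finsupp.degree_single, Finsupp.degree_single]
  refine ⟨m, o1 - q - 1, hot, ?_, by omega, h1m, hr1, hkept, ?_, ?_⟩
  · rw [ho1]; congr 1; omega
  · rw [hr2, show o1 - q - 1 + 1 = o1 - q by omega]
  · rw [ho2]; congr 1; omega

/-- **THE DEFECTIVE LOSS IS WIDE (PROVED).**  A total loss at a plateau stage of a SMALL plateau (`r_{t+1}(j) + 1 ≤ s`) whose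
order after the loss is neither `q` nor `q + 1` forces `q + 3 ≤ 2s`. [new] [folklore] -/
theorem defect_loss_wide (hroot : IsRoot q s₀) (W : ForcedWalk q s₀) (t : ℕ) {s : ℕ}
    (hsh0 : (W.st t).shade = (s : ℕ∞)) (hsh1 : (W.st (t + 1)).shade = (s : ℕ∞))
    (hloss : ∀ y, y ≠ W.j t → (W.st (t + 1)).r y = 0) (hne : ordZero (W.st t).F ≠ ((q : ℕ) : ℕ∞))
    (hne1 : ordZero (W.st (t + 1)).F ≠ ((q : ℕ) : ℕ∞)) (hnb : ordZero (W.st (t + 1)).F ≠ ((q + 1 : ℕ) : ℕ∞))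
    (hsmall : (W.st (t + 1)).r (W.j t) + 1 ≤ s) : q + 3 ≤ 2 * s := by
  classical
  obtain ⟨m, -, hot1, -, -, -, hr1⟩ := loss_data hroot W t hsh0 hsh1 hloss hne
  obtain ⟨o1, ho1, hqo1⟩ := walk_nat hroot W (t + 1)
  have ho1' : o1 = s + m := by have h := ho1.symm.trans hot1; exact_mod_cast h
  have ho1q : o1 ≠ q := by intro h; rw [h] at ho1; exact hne1 ho1
  have ho1b : o1 ≠ q + 1 := by intro h; rw [h] at ho1; exact hnb ho1
  rw [hr1, Finsupp.single_apply, if_pos rfl] at hsmall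
  omega

end Ledger

/-! ## §2 The STAYS form of `LossIsFatal` and the reduction (strong induction on the loss parameter `m`) -/

/-- `LossIsFatalDeep` restricted to total losses FOLLOWED BY A PROXIMITY REPEAT (`StaysOnNewest W t`: the next move switches
chart and its centre lies on the wall the loss created).  Binders of `LossIsFatal.LossIsFatalDeep` VERBATIM, one extra binder
`StaysOnNewest W t` before `False`.  OPEN. [new] -/
def LossIsFatalStaysDeep : Prop :=
  ∀ p : ℕ, p.Prime → ∀ e : ℕ, 2 ≤ e → ∀ (K : Type) [Field K] [CharP K p] [PerfectField K] [DecidableEq K]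
    (s₀ : State (Fin 3) K), IsRoot (p ^ e) s₀ → ∀ W : ForcedWalk (p ^ e) s₀, (∀ i, 1 ≤ (W.st i).shade) →
    ∀ N : ℕ, (∀ t, N ≤ t → (W.st (t + 1)).shade = (W.st t).shade) →
    (∀ t, N ≤ t → ordZero (W.st t).F ≠ ((p ^ e : ℕ) : ℕ∞)) → (∀ M : ℕ, ∃ t, M ≤ t ∧ StaysOnNewest W t) →
    (∀ M : ℕ, ∃ t, M ≤ t ∧ W.b t ≠ 0) →
    ∀ s : ℕ, (W.st N).shade = (s : ℕ∞) → 3 ≤ s → p ^ e + 3 ≤ 3 * s → p ^ e + 2 ≤ 2 * s → s < p ^ e →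
    (∀ (k : Fin 3) (N' : ℕ), ∃ t, N' ≤ t ∧ (W.j t = k ∨ W.b t k ≠ 0)) →
    (∀ t, N ≤ t → ((∀ y, (W.st t).r y + 1 ≤ s) ∧ ∃ x, (W.st t).r x = 0 ∧
      ∃ d ∈ (W.st t).F.support, ((d.degree : ℕ) : ℕ∞) = ordZero (W.st t).F ∧ (W.st t).r x < d x)) →
    ∀ t : ℕ, N ≤ t → (∀ y, y ≠ W.j t → (W.st (t + 1)).r y = 0) → StaysOnNewest W t → False

/-- **REDUCTION TO THE STAYS FORM (PROVED, hypothesis-free):** consecutive total losses have strictly decreasing parameter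
`m = ordZero F_t − q` (`m' = s + m − q`, `s < q`), so the last loss of a maximal chain of consecutive losses is followed by a
proximity repeat (`loss_consecutive`). [new] [folklore] -/
theorem lossIsFatalDeep_of_stays (h : LossIsFatalStaysDeep) : LossIsFatalDeep := by
  intro p hp e he K _ _ _ _ s₀ hroot W hpos N hplat hne hS hb s hsN h3 h33 h22 hlt hcoord hsd t hNt hloss
  have hconst := shade_eq_of_plateau W hplat hsN
  have key : ∀ n t : ℕ, N ≤ t → (∀ y, y ≠ W.j t → (W.st (t + 1)).r y = 0) →
      ordZero (W.st t).F = ((p ^ e + n : ℕ) : ℕ∞) → False := by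
    intro n
    induction n using Nat.strong_induction_on with
    | _ n ih =>
      intro t hNt hloss hot
      by_cases hst : StaysOnNewest W t
      · exact h p hp e he K s₀ hroot W hpos N hplat hne hS hb s hsN h3 h33 h22 hlt hcoord hsd t hNt hloss hst
      · have hloss' := loss_consecutive hroot W t (hconst t hNt) (hconst (t + 1) (by omega)) hloss (hne t hNt) hst
        obtain ⟨m, hot', hot1, h1m, -, -, -⟩ :=
          loss_data hroot W t (hconst t hNt) (hconst (t + 1) (by omega)) hloss (hne t hNt)
        have hnm : n = m := by
          have h1 := hot.symm.trans hot'
          have h2 : p ^ e + n = p ^ e + m := by exact_mod_cast h1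
          omega
        obtain ⟨o1, ho1, hqo1⟩ := walk_nat hroot W (t + 1)
        have ho1' : o1 = s + m := by have h1 := ho1.symm.trans hot1; exact_mod_cast h1
        have ho1q : o1 ≠ p ^ e := by intro h1; rw [h1] at ho1; exact hne (t + 1) (by omega) ho1
        refine ih (s + m - p ^ e) (by omega) (t + 1) (by omega) hloss' ?_
        rw [ho1]; congr 1; omega
  obtain ⟨m, hot, -, -, -, -, -⟩ := loss_data hroot W t (hconst t hNt) (hconst (t + 1) (by omega)) hloss (hne t hNt)
  exact key m t hNt hloss hot

/-- BRANCH `δ = 0` OF THE STAYS FORM (bottom loss followed by a proximity repeat): binders of `LossIsFatalStaysDeep` with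
`ordZero F_{t+1} = pᵉ + 1` inserted before `StaysOnNewest W t`.  By `loss_stays_shape` the walk then sits at
`r_{t+2} = m·e_j + e_i`, `ordZero F_{t+2} = pᵉ + 2` — the root of the run families T1–T5 of NODE-g26 §8.  OPEN. [new] -/
def LossIsFatalBottomStaysDeep : Prop :=
  ∀ p : ℕ, p.Prime → ∀ e : ℕ, 2 ≤ e → ∀ (K : Type) [Field K] [CharP K p] [PerfectField K] [DecidableEq K]
    (s₀ : State (Fin 3) K), IsRoot (p ^ e) s₀ → ∀ W : ForcedWalk (p ^ e) s₀, (∀ i, 1 ≤ (W.st i).shade) →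
    ∀ N : ℕ, (∀ t, N ≤ t → (W.st (t + 1)).shade = (W.st t).shade) →
    (∀ t, N ≤ t → ordZero (W.st t).F ≠ ((p ^ e : ℕ) : ℕ∞)) → (∀ M : ℕ, ∃ t, M ≤ t ∧ StaysOnNewest W t) →
    (∀ M : ℕ, ∃ t, M ≤ t ∧ W.b t ≠ 0) →
    ∀ s : ℕ, (W.st N).shade = (s : ℕ∞) → 3 ≤ s → p ^ e + 3 ≤ 3 * s → p ^ e + 2 ≤ 2 * s → s < p ^ e →
    (∀ (k : Fin 3) (N' : ℕ), ∃ t, N' ≤ t ∧ (W.j t = k ∨ W.b t k ≠ 0)) →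
    (∀ t, N ≤ t → ((∀ y, (W.st t).r y + 1 ≤ s) ∧ ∃ x, (W.st t).r x = 0 ∧
      ∃ d ∈ (W.st t).F.support, ((d.degree : ℕ) : ℕ∞) = ordZero (W.st t).F ∧ (W.st t).r x < d x)) →
    ∀ t : ℕ, N ≤ t → (∀ y, y ≠ W.j t → (W.st (t + 1)).r y = 0) →
    ordZero (W.st (t + 1)).F = ((p ^ e + 1 : ℕ) : ℕ∞) → StaysOnNewest W t → False

/-- BRANCH `δ ≥ 1` OF THE STAYS FORM (defective loss followed by a proximity repeat), WITH the free confinement binder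
`pᵉ + 3 ≤ 2s` (`defect_loss_wide`) inserted after `s < pᵉ` and `ordZero F_{t+1} ≠ pᵉ + 1` before `StaysOnNewest W t`.
Empty below the wide cells (`(8,6)`, `(9,6)`, `(9,7)`, `(16,10)`, …).  OPEN. [new] -/
def LossIsFatalDefectStaysDeep : Prop :=
  ∀ p : ℕ, p.Prime → ∀ e : ℕ, 2 ≤ e → ∀ (K : Type) [Field K] [CharP K p] [PerfectField K] [DecidableEq K]
    (s₀ : State (Fin 3) K), IsRoot (p ^ e) s₀ → ∀ W : ForcedWalk (p ^ e) s₀, (∀ i, 1 ≤ (W.st i).shade) →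
    ∀ N : ℕ, (∀ t, N ≤ t → (W.st (t + 1)).shade = (W.st t).shade) →
    (∀ t, N ≤ t → ordZero (W.st t).F ≠ ((p ^ e : ℕ) : ℕ∞)) → (∀ M : ℕ, ∃ t, M ≤ t ∧ StaysOnNewest W t) →
    (∀ M : ℕ, ∃ t, M ≤ t ∧ W.b t ≠ 0) →
    ∀ s : ℕ, (W.st N).shade = (s : ℕ∞) → 3 ≤ s → p ^ e + 3 ≤ 3 * s → p ^ e + 2 ≤ 2 * s → s < p ^ e →
    p ^ e + 3 ≤ 2 * s →
    (∀ (k : Fin 3) (N' : ℕ), ∃ t, N' ≤ t ∧ (W.j t = k ∨ W.b t k ≠ 0)) →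
    (∀ t, N ≤ t → ((∀ y, (W.st t).r y + 1 ≤ s) ∧ ∃ x, (W.st t).r x = 0 ∧
      ∃ d ∈ (W.st t).F.support, ((d.degree : ℕ) : ℕ∞) = ordZero (W.st t).F ∧ (W.st t).r x < d x)) →
    ∀ t : ℕ, N ≤ t → (∀ y, y ≠ W.j t → (W.st (t + 1)).r y = 0) →
    ordZero (W.st (t + 1)).F ≠ ((p ^ e + 1 : ℕ) : ℕ∞) → StaysOnNewest W t → False

/-- ASSEMBLY OF THE TWO STAYS BRANCHES (PROVED): the defect is pinned, and in the defective case the confinement binder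
`pᵉ + 3 ≤ 2s` is supplied by `defect_loss_wide` (SMALL at `t+1`). [new] [folklore] -/
theorem lossIsFatalStaysDeep_of_branches (h0 : LossIsFatalBottomStaysDeep) (h1 : LossIsFatalDefectStaysDeep) :
    LossIsFatalStaysDeep := by
  intro p hp e he K _ _ _ _ s₀ hroot W hpos N hplat hne hS hb s hsN h3 h33 h22 hlt hcoord hsd t hNt hloss hst
  by_cases ho : ordZero (W.st (t + 1)).F = ((p ^ e + 1 : ℕ) : ℕ∞)
  · exact h0 p hp e he K s₀ hroot W hpos N hplat hne hS hb s hsN h3 h33 h22 hlt hcoord hsd t hNt hloss ho hst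
  · have hconst := shade_eq_of_plateau W hplat hsN
    have hwide := defect_loss_wide hroot W t (hconst t hNt) (hconst (t + 1) (by omega)) hloss (hne t hNt)
      (hne (t + 1) (by omega)) ho ((hsd (t + 1) (by omega)).1 (W.j t))
    exact h1 p hp e he K s₀ hroot W hpos N hplat hne hS hb s hsN h3 h33 h22 hlt hwide hcoord hsd t hNt hloss ho hst

/-- `LossIsFatalDeep` from the two STAYS branches (PROVED). [new] [folklore] -/
theorem lossIsFatalDeep_of_stays_branches (h0 : LossIsFatalBottomStaysDeep) (h1 : LossIsFatalDefectStaysDeep) :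
    LossIsFatalDeep :=
  lossIsFatalDeep_of_stays (lossIsFatalStaysDeep_of_branches h0 h1)

/-- **THE LOCATED RESIDUAL FROM THE TWO STAYS BRANCHES (PROVED, hypothesis-free):**
`LossIsFatalBottomStaysDeep → LossIsFatalDefectStaysDeep → WallCut.NoLossyStrictTailsDeep`. [new] [folklore] -/
theorem noLossyStrictTailsDeep_of_stays_branches (h0 : LossIsFatalBottomStaysDeep) (h1 : LossIsFatalDefectStaysDeep) :
    NoLossyStrictTailsDeep :=
  noLossyStrictTailsDeep_of_lossIsFatalDeep (lossIsFatalDeep_of_stays_branches h0 h1)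

/-- The STAYS branches imply the g26 branches' assembly target and conversely the g26 bottom branch implies the bottom STAYS
branch (PROVED, pure logic) — so nothing typed in `LossIsFatal` is orphaned. [folklore] -/
theorem lossIsFatalBottomStaysDeep_of_bottom (h : LossIsFatalBottomDeep) : LossIsFatalBottomStaysDeep := by
  intro p hp e he K _ _ _ _ s₀ hroot W hpos N hplat hne hS hb s hsN h3 h33 h22 hlt hcoord hsd t hNt hloss ho _
  exact h p hp e he K s₀ hroot W hpos N hplat hne hS hb s hsN h3 h33 h22 hlt hcoord hsd t hNt hloss ho

end Summit.ResolutionOfSingularities.ResolutionOfSingularities.Theorems.LossIsFatalLedger
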